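import Summits.CriticalPhenomena.CardyFormulaZ2.Theorems.CardyUniqueLimitCardyRigidityDefs
import Summits.CriticalPhenomena.CardyFormulaZ2.Theorems.DyadicBetaRigidityDyadicBetaSufficesBeta
import HarnessLib

/-!
# `CardyRigidity` (stmt-CriticalPhenomena-0746), line `crossing-martingale`: the beta laws `I_a`,
# `a < 1`, are strictly increasing on `[0,1)` — and the literal non-degenerate strengthening of
# `stub_kernelAffineBeta` is false

By-product of the standing disprover (cdisprove) of the crux `CardyRigidity` for the provers of the
picked line `Cruxes/CardyRigidity/Lines/crossing_martingale.lean`.  All objects are the line's own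
(`betaLaw`, `IsRegularDriver`, `IsCrossingMartingaleFamily`, … from the landed definitions module
`Theorems/CardyUniqueLimitCardyRigidityDefs.lean`); positivity and integrability of the beta kernel
`(s(1-s))^{-a}`, `a < 1`, are the tree's (`DyadicLattice.symmBetaKernel_pos`,
`DyadicLattice.intervalIntegrable_symmBetaKernel_of_mem`, `DyadicLattice.beta_pos`, route
DyadicBetaRigidity's glue file).

* `betaLaw_strictMonoOn` — `I_a` is strictly increasing on `[0, 1)` for `a < 1` (in particular no
  `0/0` junk inside the range `a ∈ (0,1)` of the stubs; for `a ≥ 1` the normalising integral is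
  Lean-junk `0` and `betaLaw a ≡ 0`);
* `not_stub_kernelAffineBeta_nondegenerate_general` — the strengthening of STUB C's conclusion to
  `∃ a ∈ (0,1), ∃ A B, A ≠ 0 ∧ f = A·I_a + B on (0,1)` is FALSE: the constant kernel `f ≡ 0` has the
  crossing-martingale property for every driver (here the zero driver on the one-point probability
  space), and no `I_a`, `a ∈ (0,1)`, is constant on `(0,1)`.  The affine degeneracy `A = 0` in the
  registered conclusion of `stub_kernelAffineBeta` is therefore necessary.
-/

noncomputable section

open MeasureTheory Filter Set Topology
open scoped NNReal ENNReal
open Summit.CriticalPhenomena.CardyFormulaZ2.Cruxes.CardyRigidity.CrossingMartingale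
open Summit.CriticalPhenomena.CardyFormulaZ2.Theorems.DyadicLattice

namespace Summit.CriticalPhenomena.CardyFormulaZ2.Theorems.CardyRigidity.Negative

/-! ### `I_a` is strictly increasing on `[0, 1)` for `a < 1` -/

/-- **`I_a` is strictly increasing on `[0, 1)`** for `a < 1`: the increment
`I_a(η₂) - I_a(η₁) = ∫_{η₁}^{η₂} (s(1-s))^{-a} ds / ∫₀¹ (s(1-s))^{-a} ds` is positive.
[cite: Cardy1992, eq. (8)] -/
theorem betaLaw_strictMonoOn {a : ℝ} (ha : a < 1) : StrictMonoOn (betaLaw a) (Ico 0 1) := by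
  intro η₁ hη₁ η₂ hη₂ h12
  unfold betaLaw
  rw [div_lt_div_iff_of_pos_right (beta_pos ha), ← sub_pos]
  have hI₂ := intervalIntegrable_symmBetaKernel_of_mem ha ⟨le_rfl, zero_le_one⟩ ⟨hη₂.1, hη₂.2.le⟩
  have hI₁ := intervalIntegrable_symmBetaKernel_of_mem ha ⟨le_rfl, zero_le_one⟩ ⟨hη₁.1, hη₁.2.le⟩
  rw [intervalIntegral.integral_interval_sub_left hI₂ hI₁]
  exact intervalIntegral.intervalIntegral_pos_of_pos_on
    (intervalIntegrable_symmBetaKernel_of_mem ha ⟨hη₁.1, hη₁.2.le⟩ ⟨hη₂.1, hη₂.2.le⟩)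
    (fun s hs ↦ symmBetaKernel_pos a ⟨hη₁.1.trans_lt hs.1, hs.2.trans hη₂.2⟩) h12

/-- `I_a`, `a < 1`, is not constant on `(0,1)`: `I_a(1/4) < I_a(1/2)`. [folklore] -/
theorem betaLaw_quarter_lt_half {a : ℝ} (ha : a < 1) : betaLaw a (1 / 4) < betaLaw a (1 / 2) :=
  betaLaw_strictMonoOn ha ⟨by norm_num, by norm_num⟩ ⟨by norm_num, by norm_num⟩ (by norm_num)

/-! ### The literal non-degenerate strengthening of STUB C is false -/

/-- **Refuted strengthening of STUB C** (`stub_kernelAffineBeta`), literal form: adding `A ≠ 0` to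
its conclusion `∃ a ∈ (0,1), ∃ A B, f = A·I_a + B on (0,1)` makes it FALSE.  Witness: the constant
kernel `f ≡ 0` (crossing-martingale kernel of every driver — its observable is the constant
process), the zero driver on the one-point probability space `(Unit, δ)` (a regular driver), and
`betaLaw_strictMonoOn` (no `I_a`, `a < 1`, is constant on `(0,1)`).  Hence a proof of STUB C must
produce the degenerate branch `A = 0` for constant kernels, and the composition's separate use of the
boundary values (STUB D) to exclude it cannot be bypassed. [folklore] -/
theorem not_stub_kernelAffineBeta_nondegenerate_general :
    ¬ (∀ f : ℝ → ℝ, ContinuousOn f (Ioo 0 1) →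
        ∀ (Ω : Type) [MeasurableSpace Ω] (μ : Measure Ω) [IsProbabilityMeasure μ]
          (W : Ω → ℝ≥0 → ℝ) (𝓕 : Filtration ℝ≥0 ‹MeasurableSpace Ω›),
          IsRegularDriver μ W 𝓕 → IsCrossingMartingaleFamily f μ W 𝓕 →
            ∃ a ∈ Ioo (0 : ℝ) 1, ∃ A B : ℝ, A ≠ 0 ∧
              EqOn f (fun η ↦ A * betaLaw a η + B) (Ioo 0 1)) := by
  intro h
  -- the zero driver on the one-point probability space is regular
  have hreg : IsRegularDriver (Measure.dirac ()) (fun (_ : Unit) (_ : ℝ≥0) ↦ (0 : ℝ)) ⊥ :=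
    ⟨fun _ ↦ stronglyMeasurable_const, fun _ ↦ continuous_const, fun _ ↦ rfl,
      fun _ ↦ ⟨fun _ ↦ 0, memLp_const 0, fun _ ↦ le_rfl, ae_of_all _ fun _ _ _ ↦ by simp⟩⟩
  -- the constant kernel `0` has the crossing-martingale property (constant observable)
  have hmart : IsCrossingMartingaleFamily (fun _ ↦ (0 : ℝ)) (Measure.dirac ())
      (fun (_ : Unit) (_ : ℝ≥0) ↦ (0 : ℝ)) ⊥ :=
    fun _ _ _ _ _ ↦ martingale_const _ _ _
  obtain ⟨a, ha, A, B, hA, hAB⟩ := h (fun _ ↦ 0) continuousOn_const Unit (Measure.dirac ())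
    (fun _ _ ↦ 0) ⊥ hreg hmart
  have e₁ := hAB (show (1 / 4 : ℝ) ∈ Ioo 0 1 by norm_num)
  have e₂ := hAB (show (1 / 2 : ℝ) ∈ Ioo 0 1 by norm_num)
  simp only at e₁ e₂
  have hlt := betaLaw_quarter_lt_half ha.2
  have : A * betaLaw a (1 / 4) = A * betaLaw a (1 / 2) := by linarith
  exact hlt.ne (mul_left_cancel₀ hA this)

end Summit.CriticalPhenomena.CardyFormulaZ2.Theorems.CardyRigidity.Negative

end
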